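import Summits.ABC.ABC.Theorems.TwistAmplificationSharpModerateLawLatticeGeometry

/-!
# Lattice half of `SharpModerateLaw`, support file 2/4: the `Mplus`-shell of a binary cubic form

Shell geometry of `stub_latticeHalf` (crux stmt-ABC-1975), uniform in the form, no real root-finding:
`CFact`/`exists_cfact` — a factorisation `F = ℓ₀ℓ₁ℓ₂` over `ℂ` with Plücker weights `dₖ`, `pₖ = dₖℓₖ`,
`Σ pₖ = 0`, `H = pᵢ² + pᵢpⱼ + pⱼ²`, `D = (d₀d₁d₂)²`; `norm_p_le` (on the shell every `‖pₖ‖ ≤ 2λ`,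
`λ⁶ = Y`), `exists_small` (at height `|F| ≤ m` some `‖pᵢ‖ ≤ 32√|D| m/λ²`), `realify`, and
`latticeShell_count`/`latticeShell_main`: the primitive `q` with `M ∣ det(q₀,q)`, `Y ≤ Mplus F q < 2Y`,
`|F(q)| ≤ m` number `≤ 12288·m·Y^{-1/6}/M + 6` (Kane, arXiv:1104.2635, Lemma 4 on the shell).
-/

noncomputable section

namespace Summit.ABC.ABC.Theorems.SharpModerateLaw

open Literature.NumberTheory.CubicFields
open UniqueFactorizationMonoid
open Finset

/-! ## Factorisation over `ℂ` and the covariant identities -/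

/-- A factorisation `F(u,v) = ∏ₖ (αₖ u + βₖ v)` of the form over `ℂ`, as four coefficient
identities. -/
structure CFact (F : BinaryCubic ℤ) where
  /-- `u`-coefficients of the three linear factors -/
  α : Fin 3 → ℂ
  /-- `v`-coefficients of the three linear factors -/
  β : Fin 3 → ℂ
  /-- `a = α₀α₁α₂` -/
  ha : (F.a : ℂ) = α 0 * α 1 * α 2
  /-- `b = Σ αᵢαⱼβₖ` -/
  hb : (F.b : ℂ) = α 0 * α 1 * β 2 + α 0 * β 1 * α 2 + β 0 * α 1 * α 2
  /-- `c = Σ αᵢβⱼβₖ` -/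
  hc : (F.c : ℂ) = α 0 * β 1 * β 2 + β 0 * α 1 * β 2 + β 0 * β 1 * α 2
  /-- `d = β₀β₁β₂` -/
  hd : (F.d : ℂ) = β 0 * β 1 * β 2

/-- The cyclic successor on `Fin 3`. -/
def nx : Fin 3 → Fin 3 := ![1, 2, 0]

namespace CFact

variable {F : BinaryCubic ℤ} (Φ : CFact F)

/-- The linear factor `ℓₖ(q) = αₖ q₁ + βₖ q₂`. -/
def ℓ (k : Fin 3) (q : ℤ × ℤ) : ℂ := Φ.α k * q.1 + Φ.β k * q.2

/-- The Plücker weights `dₖ = det(ℓₖ₊₁, ℓₖ₊₂)`. -/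
def d : Fin 3 → ℂ :=
  ![Φ.α 1 * Φ.β 2 - Φ.α 2 * Φ.β 1, Φ.α 2 * Φ.β 0 - Φ.α 0 * Φ.β 2, Φ.α 0 * Φ.β 1 - Φ.α 1 * Φ.β 0]

/-- `pₖ(q) = dₖ ℓₖ(q)`. -/
def p (k : Fin 3) (q : ℤ × ℤ) : ℂ := Φ.d k * Φ.ℓ k q

/-- `F(q) = ℓ₀ℓ₁ℓ₂(q)`. -/
theorem eval_eq (q : ℤ × ℤ) : (F.eval q.1 q.2 : ℂ) = Φ.ℓ 0 q * Φ.ℓ 1 q * Φ.ℓ 2 q := by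
  simp only [BinaryCubic.eval, ℓ]; push_cast
  rw [Φ.ha, Φ.hb, Φ.hc, Φ.hd]; ring

/-- `Σ pₖ = 0` (the linear dependence of three linear forms in two variables). -/
theorem p_sum (q : ℤ × ℤ) : Φ.p 0 q + Φ.p 1 q + Φ.p 2 q = 0 := by
  simp only [p, d, ℓ, Matrix.cons_val_zero, Matrix.cons_val_one, Matrix.cons_val]; ring

/-- The Hessian covariant: `H(q) = p₀² + p₀p₁ + p₁²`. -/
theorem hess_eq (q : ℤ × ℤ) :
    (hessAt F q.1 q.2 : ℂ) = Φ.p 0 q ^ 2 + Φ.p 0 q * Φ.p 1 q + Φ.p 1 q ^ 2 := by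
  simp only [hessAt, p, d, ℓ, Matrix.cons_val_zero, Matrix.cons_val_one]; push_cast
  rw [Φ.ha, Φ.hb, Φ.hc, Φ.hd]; ring

/-- The discriminant: `D = (d₀d₁d₂)²`. -/
theorem disc_eq : (F.disc : ℂ) = (Φ.d 0 * Φ.d 1 * Φ.d 2) ^ 2 := by
  simp only [BinaryCubic.disc_eq, d, Matrix.cons_val_zero, Matrix.cons_val_one, Matrix.cons_val]
  push_cast
  rw [Φ.ha, Φ.hb, Φ.hc, Φ.hd]; ring

/-- `pₖ = −(pₖ₊₁ + pₖ₊₂)`. -/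
theorem p_rot (k : Fin 3) (q : ℤ × ℤ) : Φ.p k q = -(Φ.p (nx k) q + Φ.p (nx (nx k)) q) := by
  have h := Φ.p_sum q
  fin_cases k <;> simp [nx] <;> linear_combination h

/-- `H = pₖ₊₁² + pₖ₊₁pₖ₊₂ + pₖ₊₂²` for every `k`. -/
theorem hess_rot (k : Fin 3) (q : ℤ × ℤ) : (hessAt F q.1 q.2 : ℂ) =
    Φ.p (nx k) q ^ 2 + Φ.p (nx k) q * Φ.p (nx (nx k)) q + Φ.p (nx (nx k)) q ^ 2 := by
  have h := Φ.p_sum q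
  rw [Φ.hess_eq]
  fin_cases k <;> simp [nx]
  · linear_combination (Φ.p 0 q - Φ.p 2 q) * h
  · linear_combination (Φ.p 1 q - Φ.p 2 q) * h

/-- `pₖ pₖ₊₁ pₖ₊₂ = p₀p₁p₂`. -/
theorem prod_rot (k : Fin 3) (q : ℤ × ℤ) :
    Φ.p k q * Φ.p (nx k) q * Φ.p (nx (nx k)) q = Φ.p 0 q * Φ.p 1 q * Φ.p 2 q := by
  fin_cases k <;> simp [nx] <;> ring

/-- `det(pₖ, pₖ₊₁) = d₀d₁d₂` as complex linear forms. -/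
theorem det_rot (k : Fin 3) : Φ.d k * Φ.α k * (Φ.d (nx k) * Φ.β (nx k)) -
    Φ.d k * Φ.β k * (Φ.d (nx k) * Φ.α (nx k)) = Φ.d 0 * Φ.d 1 * Φ.d 2 := by
  fin_cases k <;> simp [nx, d] <;> ring

/-- `‖d₀d₁d₂‖ = √|D|`. -/
theorem norm_d : ‖Φ.d 0 * Φ.d 1 * Φ.d 2‖ = Real.sqrt |(F.disc : ℝ)| := by
  have h : ‖(F.disc : ℂ)‖ = ‖Φ.d 0 * Φ.d 1 * Φ.d 2‖ ^ 2 := by rw [Φ.disc_eq, norm_pow]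
  rw [Complex.norm_intCast] at h
  rw [h, Real.sqrt_sq (norm_nonneg _)]

/-- `‖p₀p₁p₂(q)‖ = √|D| · |F(q)|`. -/
theorem norm_prod (q : ℤ × ℤ) :
    ‖Φ.p 0 q * Φ.p 1 q * Φ.p 2 q‖ = Real.sqrt |(F.disc : ℝ)| * |(F.eval q.1 q.2 : ℝ)| := by
  have : Φ.p 0 q * Φ.p 1 q * Φ.p 2 q = (Φ.d 0 * Φ.d 1 * Φ.d 2) * (F.eval q.1 q.2 : ℂ) := by
    rw [Φ.eval_eq]; simp only [p]; ring
  rw [this, norm_mul, Φ.norm_d, Complex.norm_intCast]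

/-- **(G1)** On the shell (`256|H|³ < 2λ⁶`, `|D|F² < 2λ⁶`) every `‖pₖ‖ ≤ 2λ`. -/
theorem norm_p_le {lam : ℝ} (hlam : 0 < lam) (q : ℤ × ℤ)
    (hH : 256 * |(hessAt F q.1 q.2 : ℝ)| ^ 3 < 2 * lam ^ 6)
    (hF : |(F.disc : ℝ)| * (F.eval q.1 q.2 : ℝ) ^ 2 < 2 * lam ^ 6) (k : Fin 3) :
    ‖Φ.p k q‖ ≤ 2 * lam := by
  set x := ‖Φ.p k q‖ with hx
  set P := Φ.p (nx k) q
  set Q := Φ.p (nx (nx k)) q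
  have h1 : Φ.p k q ^ 2 = (hessAt F q.1 q.2 : ℂ) + P * Q := by
    rw [Φ.hess_rot k, Φ.p_rot k]; ring
  have h2 : x ^ 2 ≤ |(hessAt F q.1 q.2 : ℝ)| + ‖P‖ * ‖Q‖ := by
    rw [hx, ← norm_pow, h1, ← Complex.norm_intCast, ← norm_mul]; exact norm_add_le _ _
  have h3 : x * (‖P‖ * ‖Q‖) = Real.sqrt |(F.disc : ℝ)| * |(F.eval q.1 q.2 : ℝ)| := by
    rw [hx, ← norm_mul, ← norm_mul, ← mul_assoc, Φ.prod_rot k, Φ.norm_prod]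
  have hHb : |(hessAt F q.1 q.2 : ℝ)| < lam ^ 2 / 4 := by
    refine lt_of_pow_lt_pow_left₀ 3 (by positivity) ?_
    nlinarith [pow_pos hlam 6]
  have hFb : Real.sqrt |(F.disc : ℝ)| * |(F.eval q.1 q.2 : ℝ)| < 3 / 2 * lam ^ 3 := by
    refine lt_of_pow_lt_pow_left₀ 2 (by positivity) ?_
    rw [mul_pow, Real.sq_sqrt (abs_nonneg _), sq_abs]
    nlinarith [pow_pos hlam 6]
  by_contra hcon
  push Not at hcon
  have hxpos : 0 < x := by linarith
  have h4 : x ^ 3 ≤ |(hessAt F q.1 q.2 : ℝ)| * x + Real.sqrt |(F.disc : ℝ)| * |(F.eval q.1 q.2 : ℝ)| := by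
    rw [← h3]; nlinarith
  have h5 : |(hessAt F q.1 q.2 : ℝ)| * x ≤ lam ^ 2 / 4 * x := by gcongr
  have hl1 : lam ^ 2 * 4 < x ^ 2 := by nlinarith
  have hl2 : lam ^ 2 * x < x ^ 3 / 4 := by nlinarith [mul_lt_mul_of_pos_right hl1 hxpos]
  have hl3' : (2 * lam) ^ 3 < x ^ 3 := pow_lt_pow_left₀ hcon (by positivity) (by norm_num)
  have hl3 : lam ^ 3 < x ^ 3 / 8 := by nlinarith
  linarith [hl2, hl3, h4, h5, hFb, pow_pos hxpos 3]

/-- The elementary step of **(G2)**: the smallest of three complex numbers with `Σ = 0`,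
`|Pₖ² − PᵢPⱼ| ≥ λ²/8` and `‖PₖPᵢPⱼ‖ ≤ Φ` is `≤ 32 Φ/λ²`. -/
theorem small_of_order {Pk Pi Pj : ℂ} {lam Φm h : ℝ} (hlam : 0 < lam) (hsum : Pk + Pi + Pj = 0)
    (hh : h ≤ ‖Pk‖ ^ 2 + ‖Pi‖ * ‖Pj‖) (hlow : lam ^ 2 / 8 ≤ h) (hij : ‖Pi‖ ≤ ‖Pj‖)
    (hjk : ‖Pj‖ ≤ ‖Pk‖) (hprod : ‖Pk‖ * ‖Pi‖ * ‖Pj‖ ≤ Φm) : ‖Pi‖ ≤ 32 * Φm / lam ^ 2 := by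
  have hk : ‖Pk‖ ≤ ‖Pi‖ + ‖Pj‖ := by
    have : Pk = -(Pi + Pj) := by linear_combination hsum
    rw [this, norm_neg]; exact norm_add_le _ _
  have hk2 : lam ^ 2 / 16 ≤ ‖Pk‖ ^ 2 := by nlinarith [norm_nonneg Pi]
  have hjk' : ‖Pk‖ ≤ 2 * ‖Pj‖ := by linarith
  have hprod' : lam ^ 2 / 32 ≤ ‖Pk‖ * ‖Pj‖ := by nlinarith [norm_nonneg Pk]
  have hpos : 0 < ‖Pk‖ * ‖Pj‖ := by nlinarith
  rw [le_div_iff₀ (by positivity)]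
  calc ‖Pi‖ * lam ^ 2 ≤ ‖Pi‖ * (32 * (‖Pk‖ * ‖Pj‖)) := by gcongr; linarith
    _ = 32 * (‖Pk‖ * ‖Pi‖ * ‖Pj‖) := by ring
    _ ≤ 32 * Φm := by gcongr

/-- **(G2)** On the part of the shell where `256|H|³ ≥ λ⁶`, some `‖pᵢ‖ ≤ 32 √|D| m/λ²`. -/
theorem exists_small {lam m : ℝ} (hlam : 0 < lam) (q : ℤ × ℤ)
    (hlow : lam ^ 6 ≤ 256 * |(hessAt F q.1 q.2 : ℝ)| ^ 3) (hm : |(F.eval q.1 q.2 : ℝ)| ≤ m) :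
    ∃ i, ‖Φ.p i q‖ ≤ 32 * (Real.sqrt |(F.disc : ℝ)| * m) / lam ^ 2 := by
  obtain ⟨k, -, hk⟩ := Finset.exists_max_image Finset.univ (fun i => ‖Φ.p i q‖) ⟨0, mem_univ _⟩
  have hH : lam ^ 2 / 8 ≤ |(hessAt F q.1 q.2 : ℝ)| := by
    by_contra hcon; push Not at hcon
    have : |(hessAt F q.1 q.2 : ℝ)| ^ 3 < (lam ^ 2 / 8) ^ 3 := by gcongr
    nlinarith [pow_pos hlam 6]
  have h1 : |(hessAt F q.1 q.2 : ℝ)| ≤ ‖Φ.p k q‖ ^ 2 + ‖Φ.p (nx k) q‖ * ‖Φ.p (nx (nx k)) q‖ := by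
    have e : (hessAt F q.1 q.2 : ℂ) = Φ.p k q ^ 2 - Φ.p (nx k) q * Φ.p (nx (nx k)) q := by
      rw [Φ.hess_rot k, Φ.p_rot k]; ring
    rw [← Complex.norm_intCast, e, ← norm_pow, ← norm_mul]; exact norm_sub_le _ _
  have h2 : ‖Φ.p k q‖ * ‖Φ.p (nx k) q‖ * ‖Φ.p (nx (nx k)) q‖ ≤ Real.sqrt |(F.disc : ℝ)| * m := by
    rw [← norm_mul, ← norm_mul, Φ.prod_rot k, Φ.norm_prod]; gcongr
  have hsum : Φ.p k q + Φ.p (nx k) q + Φ.p (nx (nx k)) q = 0 := by rw [Φ.p_rot k]; ring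
  rcases le_total ‖Φ.p (nx k) q‖ ‖Φ.p (nx (nx k)) q‖ with h | h
  · exact ⟨nx k, small_of_order hlam hsum h1 hH h (hk _ (mem_univ _)) h2⟩
  · refine ⟨nx (nx k), small_of_order hlam (by rw [← hsum]; ring) (by rwa [mul_comm]) hH h
      (hk _ (mem_univ _)) (by rwa [mul_right_comm])⟩

end CFact

/-- Every integral binary cubic form factors over `ℂ` into three linear forms. -/
theorem exists_cfact (F : BinaryCubic ℤ) : Nonempty (CFact F) := by
  -- generic case `a ≠ 0` for a form `G` with complex coefficients cast from `ℤ`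
  have key : ∀ G : BinaryCubic ℤ, G.a ≠ 0 → Nonempty (CFact G) := by
    intro G ha
    let P : Cubic ℂ := ⟨G.a, G.b, G.c, G.d⟩
    have hPa : P.a ≠ 0 := by simp only [P]; exact_mod_cast ha
    have hspl : (P.toPoly.map (RingHom.id ℂ)).Splits := by
      rw [Polynomial.map_id]; exact IsAlgClosed.splits _
    obtain ⟨x, y, z, h3⟩ := (Cubic.splits_iff_roots_eq_three hPa).mp hspl
    have hb := Cubic.b_eq_three_roots hPa h3
    have hc := Cubic.c_eq_three_roots hPa h3
    have hd := Cubic.d_eq_three_roots hPa h3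
    simp only [RingHom.id_apply, P] at hb hc hd
    exact ⟨⟨![(G.a : ℂ), 1, 1], ![-(G.a : ℂ) * x, -y, -z], by simp, by simp [hb]; ring,
      by simp [hc]; ring, by simp [hd]; ring⟩⟩
  by_cases ha : F.a ≠ 0
  · exact key F ha
  by_cases hd : F.d ≠ 0
  · -- reverse the form
    obtain ⟨Ψ⟩ := key ⟨F.d, F.c, F.b, F.a⟩ hd
    refine ⟨⟨Ψ.β, Ψ.α, ?_, ?_, ?_, ?_⟩⟩
    · exact Ψ.hd
    · have := Ψ.hc; simp only at this; rw [this]; ring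
    · have := Ψ.hb; simp only at this; rw [this]; ring
    · have := Ψ.ha; simp only at this; rw [this]
  · push Not at ha hd
    exact ⟨⟨![1, 0, (F.b : ℂ)], ![0, 1, (F.c : ℂ)], by simp [ha], by simp, by simp, by simp [hd]⟩⟩

/-- Realification: two complex linear forms with `det = Δ` dominate a real parallelogram gauge
with `|det| ≥ ‖Δ‖/4`. -/
theorem realify (s t s' t' : ℂ) : ∃ a b c d : ℝ, ‖s * t' - t * s'‖ ≤ 4 * |a * d - b * c| ∧
    ∀ q : ℤ × ℤ, |a * q.1 + b * q.2| ≤ ‖s * q.1 + t * q.2‖ ∧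
      |c * q.1 + d * q.2| ≤ ‖s' * q.1 + t' * q.2‖ := by
  have hre : ∀ s t : ℂ, ∀ q : ℤ × ℤ, |s.re * q.1 + t.re * q.2| ≤ ‖s * q.1 + t * q.2‖ := by
    intro s t q
    have : s.re * q.1 + t.re * q.2 = (s * q.1 + t * q.2).re := by simp
    rw [this]; exact Complex.abs_re_le_norm _
  have him : ∀ s t : ℂ, ∀ q : ℤ × ℤ, |s.im * q.1 + t.im * q.2| ≤ ‖s * q.1 + t * q.2‖ := by
    intro s t q
    have : s.im * q.1 + t.im * q.2 = (s * q.1 + t * q.2).im := by simp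
    rw [this]; exact Complex.abs_im_le_norm _
  set Δ := s * t' - t * s'
  have h1 : Δ.re = (s.re * t'.re - t.re * s'.re) - (s.im * t'.im - t.im * s'.im) := by
    simp only [Δ, Complex.sub_re, Complex.mul_re]; ring
  have h2 : Δ.im = (s.re * t'.im - t.re * s'.im) + (s.im * t'.re - t.im * s'.re) := by
    simp only [Δ, Complex.sub_im, Complex.mul_im]; ring
  have hkey : ‖Δ‖ ≤ |s.re * t'.re - t.re * s'.re| + |s.im * t'.im - t.im * s'.im| +
      |s.re * t'.im - t.re * s'.im| + |s.im * t'.re - t.im * s'.re| := by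
    calc ‖Δ‖ ≤ |Δ.re| + |Δ.im| := Complex.norm_le_abs_re_add_abs_im _
      _ ≤ _ := by
        rw [h1, h2]
        linarith [abs_sub (s.re * t'.re - t.re * s'.re) (s.im * t'.im - t.im * s'.im),
          abs_add_le (s.re * t'.im - t.re * s'.im) (s.im * t'.re - t.im * s'.re)]
  by_cases c1 : ‖Δ‖ ≤ 4 * |s.re * t'.re - t.re * s'.re|
  · exact ⟨s.re, t.re, s'.re, t'.re, c1, fun q => ⟨hre s t q, hre s' t' q⟩⟩
  by_cases c2 : ‖Δ‖ ≤ 4 * |s.im * t'.im - t.im * s'.im|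
  · exact ⟨s.im, t.im, s'.im, t'.im, c2, fun q => ⟨him s t q, him s' t' q⟩⟩
  by_cases c3 : ‖Δ‖ ≤ 4 * |s.re * t'.im - t.re * s'.im|
  · exact ⟨s.re, t.re, s'.im, t'.im, c3, fun q => ⟨hre s t q, him s' t' q⟩⟩
  refine ⟨s.im, t.im, s'.re, t'.re, ?_, fun q => ⟨him s t q, hre s' t' q⟩⟩
  push Not at c1 c2 c3
  linarith

/-- `Mplus` over `ℝ`. -/
theorem mplus_cast (F : BinaryCubic ℤ) (q : ℤ × ℤ) : (Mplus F q : ℝ) =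
    max (|(F.disc : ℝ)| * (F.eval q.1 q.2 : ℝ) ^ 2) (256 * |(hessAt F q.1 q.2 : ℝ)| ^ 3) := by
  simp only [Mplus, Nat.cast_max, Nat.cast_mul, Nat.cast_pow, Nat.cast_natAbs, Nat.cast_ofNat]
  push_cast
  rw [abs_mul, abs_pow, sq_abs]

/-- **Primitive lattice points in the `Mplus`-shell at height `|F| ≤ m`** (Kane's Lemma 4 on the
shell of one binary cubic form, uniformly in the form): for `D ≠ 0`, `Y > 0`, `m > 0`, `q₀`
primitive and `M ≥ 1`, the primitive `q` with `M ∣ det(q₀,q)`, `Y ≤ Mplus F q < 2Y`, `|F(q)| ≤ m` are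
finitely many, at most `12288 · m · Y^{-1/6}/M + 6`. -/
theorem latticeShell_count (F : BinaryCubic ℤ) (hD : F.disc ≠ 0) {Y m : ℝ} (hY : 0 < Y)
    (hm : 0 < m) {q₀ : ℤ × ℤ} (hq₀ : Int.gcd q₀.1 q₀.2 = 1) {M : ℕ} (hM : 0 < M) :
    {q : ℤ × ℤ | Int.gcd q.1 q.2 = 1 ∧ (M : ℤ) ∣ dt q₀ q ∧ Y ≤ (Mplus F q : ℝ) ∧
        (Mplus F q : ℝ) < 2 * Y ∧ |(F.eval q.1 q.2 : ℝ)| ≤ m}.Finite ∧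
      (({q : ℤ × ℤ | Int.gcd q.1 q.2 = 1 ∧ (M : ℤ) ∣ dt q₀ q ∧ Y ≤ (Mplus F q : ℝ) ∧
        (Mplus F q : ℝ) < 2 * Y ∧ |(F.eval q.1 q.2 : ℝ)| ≤ m}.ncard : ℕ) : ℝ) ≤
        12288 * m * Y ^ (-(1 / 6 : ℝ)) / M + 6 := by
  set S := {q : ℤ × ℤ | Int.gcd q.1 q.2 = 1 ∧ (M : ℤ) ∣ dt q₀ q ∧ Y ≤ (Mplus F q : ℝ) ∧
        (Mplus F q : ℝ) < 2 * Y ∧ |(F.eval q.1 q.2 : ℝ)| ≤ m}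
  obtain ⟨Φ⟩ := exists_cfact F
  set lam : ℝ := Y ^ (1 / 6 : ℝ) with hlamdef
  have hlam : 0 < lam := Real.rpow_pos_of_pos hY _
  have hlam6 : lam ^ 6 = Y := by
    rw [hlamdef, ← Real.rpow_natCast, ← Real.rpow_mul hY.le]; norm_num
  have hYneg : Y ^ (-(1 / 6 : ℝ)) = lam⁻¹ := by rw [Real.rpow_neg hY.le]
  rw [hYneg]
  have hMr : (0 : ℝ) < M := by exact_mod_cast hM
  have hDpos : 0 < |(F.disc : ℝ)| := abs_pos.mpr (by exact_mod_cast hD)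
  set σ := Real.sqrt |(F.disc : ℝ)| with hσ
  have hσpos : 0 < σ := Real.sqrt_pos.mpr hDpos
  -- shell bounds for the members of `S`
  have hmem : ∀ q ∈ S, 256 * |(hessAt F q.1 q.2 : ℝ)| ^ 3 < 2 * lam ^ 6 ∧
      |(F.disc : ℝ)| * (F.eval q.1 q.2 : ℝ) ^ 2 < 2 * lam ^ 6 := by
    intro q hq
    have h := hq.2.2.2.1
    rw [mplus_cast, max_lt_iff, ← hlam6] at h
    exact ⟨h.2, h.1⟩
  -- the three realified parallelograms
  have hreal := fun i : Fin 3 => realify (Φ.d i * Φ.α i) (Φ.d i * Φ.β i)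
    (Φ.d (nx i) * Φ.α (nx i)) (Φ.d (nx i) * Φ.β (nx i))
  choose ra rb rc rd hdet hdom using hreal
  have hdet' : ∀ i, σ / 4 ≤ |ra i * rd i - rb i * rc i| := by
    intro i
    have h := hdet i
    rw [show Φ.d i * Φ.α i * (Φ.d (nx i) * Φ.β (nx i)) - Φ.d i * Φ.β i * (Φ.d (nx i) * Φ.α (nx i))
      = Φ.d 0 * Φ.d 1 * Φ.d 2 from Φ.det_rot i, Φ.norm_d] at h
    linarith
  have hdet0 : ∀ i, ra i * rd i - rb i * rc i ≠ 0 := fun i =>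
    abs_pos.mp (lt_of_lt_of_le (by positivity) (hdet' i))
  have hp_eq : ∀ i (q : ℤ × ℤ), Φ.d i * Φ.α i * q.1 + Φ.d i * Φ.β i * q.2 = Φ.p i q := by
    intro i q; simp only [CFact.p, CFact.ℓ]; ring
  -- the parallelogram pieces
  let T : Fin 3 → ℝ → Set (ℤ × ℤ) := fun i r => {q : ℤ × ℤ | Int.gcd q.1 q.2 = 1 ∧
    (M : ℤ) ∣ dt q₀ q ∧ |ra i * q.1 + rb i * q.2| ≤ r ∧ |rc i * q.1 + rd i * q.2| ≤ 2 * lam}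
  have hT : ∀ i, ∀ r : ℝ, 0 < r → (T i r).Finite ∧
      (((T i r).ncard : ℕ) : ℝ) ≤ 128 * r * lam / (M * σ) + 2 := by
    intro i r hr
    obtain ⟨hfin, hcard⟩ := lattice_prim_count (hdet0 i) hr (by positivity : 0 < 2 * lam) hq₀ hM
    refine ⟨hfin, hcard.trans ?_⟩
    gcongr ?_ + 2
    calc 16 * r * (2 * lam) / (M * |ra i * rd i - rb i * rc i|)
        ≤ 16 * r * (2 * lam) / (M * (σ / 4)) := by
          gcongr
          exact hdet' i
      _ = 128 * r * lam / (M * σ) := by field_simp; ring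
  by_cases hcase : |(F.disc : ℝ)| * m ^ 2 < Y
  · -- small height: three parallelograms of width `32 σ m / λ²`
    set r : ℝ := 32 * (σ * m) / lam ^ 2 with hr
    have hrpos : 0 < r := by positivity
    have hsub : S ⊆ T 0 r ∪ T 1 r ∪ T 2 r := by
      intro q hq
      obtain ⟨hH, hF⟩ := hmem q hq
      have hlow : lam ^ 6 ≤ 256 * |(hessAt F q.1 q.2 : ℝ)| ^ 3 := by
        have h := hq.2.2.1
        rw [mplus_cast, le_max_iff, ← hlam6] at h
        rcases h with h | h
        · exfalso
          have : |(F.disc : ℝ)| * (F.eval q.1 q.2 : ℝ) ^ 2 ≤ |(F.disc : ℝ)| * m ^ 2 := by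
            rw [← sq_abs]; gcongr; exact hq.2.2.2.2
          linarith
        · exact h
      obtain ⟨i, hi⟩ := Φ.exists_small hlam q hlow hq.2.2.2.2
      have hqT : q ∈ T i r := by
        refine ⟨hq.1, hq.2.1, ?_, ?_⟩
        · refine le_trans (hdom i q).1 ?_
          rw [hp_eq]; exact hi
        · refine le_trans (hdom i q).2 ?_
          rw [hp_eq]; exact Φ.norm_p_le hlam q hH hF _
      fin_cases i
      · exact Or.inl (Or.inl hqT)
      · exact Or.inl (Or.inr hqT)
      · exact Or.inr hqT
    have hfin : (T 0 r ∪ T 1 r ∪ T 2 r).Finite :=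
      ((hT 0 r hrpos).1.union (hT 1 r hrpos).1).union (hT 2 r hrpos).1
    refine ⟨hfin.subset hsub, ?_⟩
    have hb : ∀ i, (((T i r).ncard : ℕ) : ℝ) ≤ 4096 * m * lam⁻¹ / M + 2 := by
      intro i
      refine le_trans (hT i r hrpos).2 (le_of_eq ?_)
      rw [hr]; field_simp; ring
    calc ((S.ncard : ℕ) : ℝ) ≤ ((T 0 r ∪ T 1 r ∪ T 2 r).ncard : ℕ) := by
          exact_mod_cast Set.ncard_le_ncard hsub hfin
      _ ≤ ((T 0 r).ncard : ℕ) + ((T 1 r).ncard : ℕ) + ((T 2 r).ncard : ℕ) := by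
          exact_mod_cast (Set.ncard_union_le _ _).trans (by gcongr; exact Set.ncard_union_le _ _)
      _ ≤ 3 * (4096 * m * lam⁻¹ / M + 2) := by linarith [hb 0, hb 1, hb 2]
      _ = 12288 * m * lam⁻¹ / M + 6 := by ring
  · -- large height: the whole shell in one parallelogram of radius `2λ`
    push Not at hcase
    have h2l : 0 < 2 * lam := by positivity
    have hsub : S ⊆ T 0 (2 * lam) := by
      intro q hq
      obtain ⟨hH, hF⟩ := hmem q hq
      refine ⟨hq.1, hq.2.1, ?_, ?_⟩
      · refine le_trans (hdom 0 q).1 ?_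
        rw [hp_eq]; exact Φ.norm_p_le hlam q hH hF _
      · refine le_trans (hdom 0 q).2 ?_
        rw [hp_eq]; exact Φ.norm_p_le hlam q hH hF _
    refine ⟨(hT 0 _ h2l).1.subset hsub, ?_⟩
    have hl3 : lam ^ 3 ≤ σ * m := by
      refine le_of_pow_le_pow_left₀ two_ne_zero (by positivity) ?_
      rw [mul_pow, hσ, Real.sq_sqrt hDpos.le]; nlinarith
    have hmain : 128 * (2 * lam) * lam / (M * σ) ≤ 256 * m * lam⁻¹ / M := by
      have e1 : 128 * (2 * lam) * lam / (M * σ) = 256 * lam ^ 3 / (lam * M * σ) := by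
        field_simp; ring
      have e2 : 256 * m * lam⁻¹ / M = 256 * (σ * m) / (lam * M * σ) := by
        field_simp
      rw [e1, e2]
      gcongr
    have hpos : 0 ≤ m * lam⁻¹ / M := by positivity
    calc ((S.ncard : ℕ) : ℝ) ≤ ((T 0 (2 * lam)).ncard : ℕ) := by
          exact_mod_cast Set.ncard_le_ncard hsub (hT 0 _ h2l).1
      _ ≤ 128 * (2 * lam) * lam / (M * σ) + 2 := (hT 0 _ h2l).2
      _ ≤ 256 * m * lam⁻¹ / M + 2 := by linarith
      _ = 256 * (m * lam⁻¹ / M) + 2 := by ring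
      _ ≤ 12288 * (m * lam⁻¹ / M) + 6 := by nlinarith
      _ = 12288 * m * lam⁻¹ / M + 6 := by ring

/-- **Registered export** (support file 2/4 of `stub_latticeHalf`): primitive points of the lattice
`{q : M ∣ det(q₀, q)}` in the `Mplus`-shell at height `|F| ≤ m` number at most
`12288 · m · Y^{-1/6} / M + 6`, uniformly in the form. -/
theorem latticeShell_main : ∀ (F : BinaryCubic ℤ), F.disc ≠ 0 → ∀ (Y m : ℝ), 0 < Y → 0 < m → ∀ (q₀ : ℤ × ℤ), Int.gcd q₀.1 q₀.2 = 1 → ∀ (M : ℕ), 0 < M → (({q : ℤ × ℤ | Int.gcd q.1 q.2 = 1 ∧ (M : ℤ) ∣ dt q₀ q ∧ Y ≤ (Mplus F q : ℝ) ∧ (Mplus F q : ℝ) < 2 * Y ∧ |(F.eval q.1 q.2 : ℝ)| ≤ m}.ncard : ℕ) : ℝ) ≤ 12288 * m * Y ^ (-(1 / 6 : ℝ)) / M + 6 :=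
  fun F hD _ _ hY hm _ hq₀ _ hM => (latticeShell_count F hD hY hm hq₀ hM).2

end Summit.ABC.ABC.Theorems.SharpModerateLaw

end
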